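import Summits.QuantumFields.YangMills.Theorems.DressedRitz.Negative.DressedTowerPair
import HarnessLib

/-!
# Route `LuscherReduction`, crux `DressedRitz` (stmt-QuantumFields-20205), line «polyakovlift» r5 — NEGATIVE lane:
# the UPPER half of (o5) and the cross-channel clause (o6), on exact levels and on dressed two-level pairs

Negative-side support lemmas of the standing disprover (seat `ym-cdisprove-20205-1`, GEN 4), sequel of `DressedMixtureHazard.lean` (p541427) and
`DressedTowerPair.lean` (p543469).  GEN 3 recorded what (o4) and the LOWER (o5) inequality forbid (an intruder level BELOW the channel: dressed leakage
WEIGHT `δ ≲ CΛ/Δε`).  This file does the same for the two clause parts that the lead's interlacing modules (`RitzInterlace.ritz_le_levelValue`, p544443;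
`KTGen.LevelUpperAt` ∕ `KTGen.dressedRitzAt_of_lower_levels`, file `LuscherReductionDressedRitzUpperFromLevels.lean`) isolate as the part of S-POS-core that
no variational argument supplies: the UPPER (o5) inequality, and the commutator clause (o6).  Nothing here asserts or refutes a route item.

* §1 (o5) ON AN EXACT LEVEL (`o5_slot_iff_of_eigen`, ★ `not_dynamicCoreClauses_of_level_above`, `not_dynamicCoreClauses_of_level_below`): if slot `i` of
  a family `u` carries an exact physical eigenvector (`K_β v = κ•v`, `‖v‖² > 0`), the (o5) pair of `DynamicCoreClauses k C β u` at `i` is LITERALLY the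
  two-sided comparison `κ·μ₀(B) ≤ e^{CΛ²/L}·μ_{i+1}(B)·λ₀ ∧ μ_{i+1}(B)·λ₀ ≤ e^{CΛ²/L}·κ·μ₀(B)` of that fine level with the one-site position
  (`B = oneSiteCoupling β L`).  So even for perfectly concentrated channel vectors the upper (o5) inequality at slot `i` is a LOWER bound on the fine
  excitation energy of the level the channel sits on — the anti-variational direction, of the same shape as `KTGen.LevelUpperAt` — which interlacing
  (`ρ_j ≤ λ_j`, p544443) cannot give.  Kernel form of the observation that upper (o5) is genuine spectral content of the line, channel by channel.
* §2 UPWARD LEAKAGE (★★ `not_dynamicCoreClauses_of_upward_weight_gap`, mirror image of GEN 3's `not_dynamicCoreClauses_of_weight_gap`): slot `i` carries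
  the dressed mixture `v = K_β^[m](ψ₁ + s•ψ₂)` of the channel level `κ₁ > 0`, sitting exactly at the one-site position (`μ_{i+1}(B)·λ₀ = κ₁·μ₀(B)`), with an
  exact intruder `ψ₂` lying ABOVE it (`γκ₁ ≤ κ₂ − κ₁`, `γ ≥ 0`) and carrying dressed weight at least `δ ≥ 0` (`δ‖v‖² ≤ s²κ₂^{2m}`); then the UPPER (o5)
  inequality fails as soon as `e^{CΛ²/L} − 1 < δγ`.  Reading for the line: upward leakage weight obeys the same NEAR bound `δ ≲ CΛ/Δε` as downward
  leakage (GEN 3), and the dressing AMPLIFIES an admixture from above by `(κ₂/κ₁)^{2m}` instead of damping it (a factor `≤ e` between tower neighbours at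
  the registered depth, `DressedTowerPair` §1).  Channel `0` has nothing above it but the vacuum, whose weight in every insertion vector is exactly `0`
  (`l2_vac_dressedLiftVec`, `o5_upper_channelZero_of_firstGap` in the lead's `…PolyakovLiftDressed.lean` ∕ `…PolyakovLiftGapBound.lean`); channels
  `i ≥ 1` have the lower tower members above them, so for them upper (o5) is a concentration statement as well as a level statement.
* §3 THE CROSS PAIR AND (o6) (closed forms `l2_pure_self`, `l2_pure_form`, `l2_pure_cross`, `l2_pure_crossForm`, `l2_crossMixture_self`,
  `l2_crossMixture_form`; ★ `crossPair_o6_number_mul_two_gram`; ★★ `not_dynamicCoreClauses_of_crossAmplitude`): slots `i ≠ l` carry the pure dressed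
  channel `a = K_β^[m]ψ₁` and a second channel leaking AMPLITUDE `s` into it, `v = K_β^[m](s•ψ₁ + ψ₂)` (`κ₁, κ₂ > 0`).  The (o6) number satisfies
  `(⟨a,Kv⟩ − ½(⟨a,Ka⟩/‖a‖² + ⟨v,Kv⟩/‖v‖²)·⟨a,v⟩)·2‖v‖² = s(κ₁κ₂)^{2m}(κ₁ − κ₂)`, and (o6) FAILS as soon as `4·CΛ²/L < a·γ`, where `a` is any lower
  bound of the normalised dressed cross amplitude (`a‖v‖ ≤ |s|κ₁^m`, leaked weight at most one half) and `γ ≥ 0` any lower bound of the splitting in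
  units of `λ₀` (`γλ₀ ≤ |κ₁ − κ₂|`).  Reading: with the tower splitting `γ ≍ ΔεΛ/L` the admissible admixture BETWEEN retained channels is an AMPLITUDE
  bound `a ≲ 4CΛ/Δε` — the square root of the weight bound (o4)/(o5) put on leakage (`δ ≲ CΛ/Δε`), i.e. one power of the small parameter more
  demanding.  PAPER POWER COUNTING (bookkeeping for provers, not a kernel statement): first-order perturbation theory of the fine zero-mode problem gives
  `a ≍ λ·|h_{il}|/Δε_{il}`, `h` the matrix of the `O(λ)` correction to Lüscher's effective Hamiltonian between one-site eigenstates [cite: Luscher1983, §3],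
  non-zero only between channels of the same symmetry type; then the (o6) number is `≍ ½·λ₀·(Λ²/L)·|h_{il}|`: (o6) is SATURATED at one loop and its
  constant must dominate `½·max_{i≠l≤k} |h_{il}|` over same-symmetry pairs (companion of GEN 1's `C ≥ max_i |ε′_i|` for (o2)); between different symmetry
  types `a = 0` exactly (isotypic separation).  On the shadow side (clause (ii) of the lead's `ShadowBudgetAt`, p541768) the corresponding amplitude is
  `O(Λ²)` relative, one power to spare.

HONEST FRAMING: fixed-lattice two-level algebra about hypotheses of stubs (`stub_universality`, `stub_pscaling`) of a child of the CONDITIONAL reduction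
route R2b1; no stub is closed or refuted; the «Reading» sentences are perturbative bookkeeping, not theorems; nothing here bears on infinite volume, the
continuum limit or the Clay mass gap.
References: M. Lüscher, NPB 219 (1983) 233 [cite: Luscher1983, §3]; M. Lüscher, U. Wolff, NPB 339 (1990) 222 [cite: LuscherWolff1990].
-/

set_option autoImplicit false

noncomputable section

open MeasureTheory Filter Topology Real
open Literature.MathematicalPhysics.QuantumFieldTheory (GaugeConfig Site gaugeTransform)
open scoped BigOperators

namespace Summit.QuantumFields.YangMills.Theorems.FemtoTransferGap.PolyakovLift.Negative

open Summit.QuantumFields.YangMills.Theorems.FemtoTransferGap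
open Summit.QuantumFields.YangMills.Theorems.FemtoTransferGap.PolyakovLift

/-! ## §1 (o5) at a slot carrying an exact level: the clause is the two-sided comparison of that level with the one-site position -/

section PureLevel

variable {L : ℕ} [NeZero L] (β : ℝ)

/-- For an exact physical eigenvector `v` (`K_β v = κ•v`, `‖v‖² > 0`) at slot `i` of a family `u`, the (o5) pair of `DynamicCoreClauses` at `i` is
equivalent to `κ·μ₀(B) ≤ e^{CΛ²/L}·μ_{i+1}(B)·λ₀ ∧ μ_{i+1}(B)·λ₀ ≤ e^{CΛ²/L}·κ·μ₀(B)`: the two-sided comparison of THAT fine level with the one-site position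
(`B = oneSiteCoupling β L`). [cite: Luscher1983, §3] -/
theorem o5_slot_iff_of_eigen {k : ℕ} (C : ℝ) {u : Fin k → (GaugeConfig 3 L SU2 → ℝ)} {i : Fin k}
    {v : GaugeConfig 3 L SU2 → ℝ} {κ : ℝ} (hui : u i = v) (hev : transferApply β v = κ • v) (hn : 0 < l2 v v) :
    (l2 (u i) (transferApply β (u i)) * levelValue su2Rep 1 (oneSiteCoupling β L) 0 ≤
          Real.exp (C * luscherLambda β L ^ 2 / L) *
            (levelValue su2Rep 1 (oneSiteCoupling β L) ((i : ℕ) + 1) * levelValue su2Rep L β 0) * l2 (u i) (u i) ∧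
        levelValue su2Rep 1 (oneSiteCoupling β L) ((i : ℕ) + 1) * levelValue su2Rep L β 0 * l2 (u i) (u i) ≤
          Real.exp (C * luscherLambda β L ^ 2 / L) *
            (l2 (u i) (transferApply β (u i)) * levelValue su2Rep 1 (oneSiteCoupling β L) 0)) ↔
      (κ * levelValue su2Rep 1 (oneSiteCoupling β L) 0 ≤
          Real.exp (C * luscherLambda β L ^ 2 / L) *
            (levelValue su2Rep 1 (oneSiteCoupling β L) ((i : ℕ) + 1) * levelValue su2Rep L β 0) ∧
        levelValue su2Rep 1 (oneSiteCoupling β L) ((i : ℕ) + 1) * levelValue su2Rep L β 0 ≤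
          Real.exp (C * luscherLambda β L ^ 2 / L) * (κ * levelValue su2Rep 1 (oneSiteCoupling β L) 0)) := by
  have hd : l2 v (transferApply β v) = κ * l2 v v := by rw [hev, l2_smul_right'']
  rw [hui, hd]
  set n := l2 v v with hn_def
  set μ0 := levelValue su2Rep 1 (oneSiteCoupling β L) 0 with hμ0_def
  set M := levelValue su2Rep 1 (oneSiteCoupling β L) ((i : ℕ) + 1) * levelValue su2Rep L β 0 with hM_def
  set E := Real.exp (C * luscherLambda β L ^ 2 / L) with hE_def
  constructor
  · rintro ⟨h1, h2⟩
    refine ⟨le_of_mul_le_mul_right ?_ hn, le_of_mul_le_mul_right ?_ hn⟩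
    · calc κ * μ0 * n = κ * n * μ0 := by ring
        _ ≤ E * M * n := h1
    · calc M * n ≤ E * (κ * n * μ0) := h2
        _ = E * (κ * μ0) * n := by ring
  · rintro ⟨h1, h2⟩
    refine ⟨?_, ?_⟩
    · calc κ * n * μ0 = κ * μ0 * n := by ring
        _ ≤ E * M * n := mul_le_mul_of_nonneg_right h1 hn.le
    · calc M * n ≤ E * (κ * μ0) * n := mul_le_mul_of_nonneg_right h2 hn.le
        _ = E * (κ * n * μ0) := by ring

/-- ★ **Upper (o5) is a lower bound on the fine excitation energy of the channel's level.**  If slot `i` of `u` carries an exact physical eigenvector with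
eigenvalue `κ` lying ABOVE the one-site position by more than the tolerance, `e^{CΛ²/L}·μ_{i+1}(B)·λ₀ < κ·μ₀(B)`, then `¬ DynamicCoreClauses k C β u` —
whatever the other slots are. [cite: Luscher1983, §3] -/
theorem not_dynamicCoreClauses_of_level_above {k : ℕ} (C : ℝ) {u : Fin k → (GaugeConfig 3 L SU2 → ℝ)} {i : Fin k}
    {v : GaugeConfig 3 L SU2 → ℝ} {κ : ℝ} (hui : u i = v) (hev : transferApply β v = κ • v) (hn : 0 < l2 v v)
    (hlt : Real.exp (C * luscherLambda β L ^ 2 / L) *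
        (levelValue su2Rep 1 (oneSiteCoupling β L) ((i : ℕ) + 1) * levelValue su2Rep L β 0) <
      κ * levelValue su2Rep 1 (oneSiteCoupling β L) 0) :
    ¬ DynamicCoreClauses k C β u := fun h =>
  (not_le.mpr hlt) ((o5_slot_iff_of_eigen β C hui hev hn).mp (h.1 i)).1

/-- The lower twin: an exact level at slot `i` lying BELOW the one-site position by more than the tolerance, `e^{CΛ²/L}·κ·μ₀(B) < μ_{i+1}(B)·λ₀`, breaks the
lower (o5) inequality: `¬ DynamicCoreClauses k C β u`. [cite: Luscher1983, §3] -/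
theorem not_dynamicCoreClauses_of_level_below {k : ℕ} (C : ℝ) {u : Fin k → (GaugeConfig 3 L SU2 → ℝ)} {i : Fin k}
    {v : GaugeConfig 3 L SU2 → ℝ} {κ : ℝ} (hui : u i = v) (hev : transferApply β v = κ • v) (hn : 0 < l2 v v)
    (hlt : Real.exp (C * luscherLambda β L ^ 2 / L) * (κ * levelValue su2Rep 1 (oneSiteCoupling β L) 0) <
      levelValue su2Rep 1 (oneSiteCoupling β L) ((i : ℕ) + 1) * levelValue su2Rep L β 0) :
    ¬ DynamicCoreClauses k C β u := fun h =>
  (not_le.mpr hlt) ((o5_slot_iff_of_eigen β C hui hev hn).mp (h.1 i)).2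

end PureLevel

/-! ## §2 Upward leakage: the UPPER (o5) inequality versus a dressed admixture of a level lying above the channel -/

section UpwardLeakage

variable {L : ℕ} [NeZero L] (β : ℝ) {ψ₁ ψ₂ : GaugeConfig 3 L SU2 → ℝ} {κ₁ κ₂ : ℝ}

/-- ★★ **Upper (o5) fails when (dressed UPWARD leakage weight) × (relative gap) exceeds the tolerance.**  Slot `i` of `u` carries `v = K_β^[m](ψ₁ + s•ψ₂)`
(`ψ₁, ψ₂` an `l2`-orthonormal physical pair of exact eigenvectors, `κ₁ > 0`), the channel level sits exactly at the one-site position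
(`μ_{i+1}(B)·λ₀ = κ₁·μ₀(B)`, `μ₀(B) > 0`), the intruder lies above (`γκ₁ ≤ κ₂ − κ₁`, `γ ≥ 0`) with dressed weight at least `δ ≥ 0`
(`δ‖v‖² ≤ s²κ₂^{2m}`); then `e^{CΛ²/L} − 1 < δγ` ⇒ `¬ DynamicCoreClauses k C β u`. [cite: Luscher1983, §3] -/
theorem not_dynamicCoreClauses_of_upward_weight_gap {k : ℕ} (C : ℝ) {u : Fin k → (GaugeConfig 3 L SU2 → ℝ)} {i : Fin k}
    (h₁ : IsPhys ψ₁) (h₂ : IsPhys ψ₂)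
    (he₁ : transferApply β ψ₁ = κ₁ • ψ₁) (he₂ : transferApply β ψ₂ = κ₂ • ψ₂)
    (hn₁ : l2 ψ₁ ψ₁ = 1) (hn₂ : l2 ψ₂ ψ₂ = 1) (h₁₂ : l2 ψ₁ ψ₂ = 0) (s : ℝ) (m : ℕ)
    (hui : u i = (transferApply (L := L) β)^[m] (ψ₁ + s • ψ₂))
    (hm0 : 0 < levelValue su2Rep 1 (oneSiteCoupling β L) 0)
    (hlev : levelValue su2Rep 1 (oneSiteCoupling β L) ((i : ℕ) + 1) * levelValue su2Rep L β 0 =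
      κ₁ * levelValue su2Rep 1 (oneSiteCoupling β L) 0)
    (hκ₁ : 0 < κ₁) {δ γ : ℝ} (hδ : 0 ≤ δ) (hγ : 0 ≤ γ)
    (hweight : δ * (κ₁ ^ (2 * m) + s ^ 2 * κ₂ ^ (2 * m)) ≤ s ^ 2 * κ₂ ^ (2 * m))
    (hgapUp : γ * κ₁ ≤ κ₂ - κ₁)
    (htol : Real.exp (C * luscherLambda β L ^ 2 / L) - 1 < δ * γ) :
    ¬ DynamicCoreClauses k C β u := by
  intro h
  have h5 := (h.1 i).1
  rw [hui, l2_dressedMixture_self β h₁ h₂ he₁ he₂ hn₁ hn₂ h₁₂, l2_dressedMixture_transferApply β h₁ h₂ he₁ he₂ hn₁ hn₂ h₁₂, hlev] at h5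
  have hd : κ₁ ^ (2 * m + 1) + s ^ 2 * κ₂ ^ (2 * m + 1) =
      κ₁ * (κ₁ ^ (2 * m) + s ^ 2 * κ₂ ^ (2 * m)) + s ^ 2 * κ₂ ^ (2 * m) * (κ₂ - κ₁) := by ring
  rw [hd] at h5
  set E := Real.exp (C * luscherLambda β L ^ 2 / L) with hE_def
  set n := κ₁ ^ (2 * m) + s ^ 2 * κ₂ ^ (2 * m) with hn_def
  set W := s ^ 2 * κ₂ ^ (2 * m) with hW_def
  set μ0 := levelValue su2Rep 1 (oneSiteCoupling β L) 0 with hμ0_def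
  have hW0 : 0 ≤ W := by
    have h2m : κ₂ ^ (2 * m) = (κ₂ ^ m) ^ 2 := by rw [← pow_mul, mul_comm]
    rw [hW_def, h2m]; positivity
  have hn0 : 0 < n := by
    have hk1 : 0 < κ₁ ^ (2 * m) := pow_pos hκ₁ _
    rw [hn_def]; linarith
  -- `δγ·κ₁‖v‖² ≤ W·(κ₂ − κ₁)` while the clause gives `W·(κ₂ − κ₁) ≤ (e^c − 1)·κ₁‖v‖² < δγ·κ₁‖v‖²`
  have hkey : δ * γ * (κ₁ * n) ≤ W * (κ₂ - κ₁) := by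
    calc δ * γ * (κ₁ * n) = (δ * n) * (γ * κ₁) := by ring
      _ ≤ W * (κ₂ - κ₁) := mul_le_mul hweight hgapUp (mul_nonneg hγ hκ₁.le) (le_trans (mul_nonneg hδ hn0.le) hweight)
  have hκn : 0 < κ₁ * n := mul_pos hκ₁ hn0
  have hlt : (E - 1) * (κ₁ * n) < W * (κ₂ - κ₁) := lt_of_lt_of_le (mul_lt_mul_of_pos_right htol hκn) hkey
  have h6 : W * (κ₂ - κ₁) * μ0 ≤ (E - 1) * (κ₁ * n) * μ0 := by linarith
  have h7 := mul_lt_mul_of_pos_right hlt hm0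
  linarith

end UpwardLeakage

/-! ## §3 The cross pair: closed forms and the amplitude bound behind (o6) -/

section CrossPair

variable {L : ℕ} [NeZero L] (β : ℝ) {ψ₁ ψ₂ : GaugeConfig 3 L SU2 → ℝ} {κ₁ κ₂ : ℝ}

/-- The cross mixture: `K_β^[m](s•ψ₁ + ψ₂) = (sκ₁^m)•ψ₁ + κ₂^m•ψ₂` for exact eigenvectors. [folklore] -/
theorem iterate_transferApply_crossMixture (h₁ : IsPhys ψ₁) (h₂ : IsPhys ψ₂)
    (he₁ : transferApply β ψ₁ = κ₁ • ψ₁) (he₂ : transferApply β ψ₂ = κ₂ • ψ₂) (s : ℝ) (m : ℕ) :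
    (transferApply (L := L) β)^[m] (s • ψ₁ + ψ₂) = (s * κ₁ ^ m) • ψ₁ + (κ₂ ^ m) • ψ₂ := by
  have h1 : s • ψ₁ + ψ₂ = s • ψ₁ + (1 : ℝ) • ψ₂ := by rw [one_smul]
  rw [h1, iterate_transferApply_lincomb β h₁ h₂ s 1 m, iterate_transferApply_eigen β he₁ m, iterate_transferApply_eigen β he₂ m,
    smul_smul, smul_smul, one_mul]

/-- Gram number of the pure dressed channel: `‖K_β^[m]ψ₁‖² = κ₁^{2m}`. [folklore] -/
theorem l2_pure_self (he₁ : transferApply β ψ₁ = κ₁ • ψ₁) (hn₁ : l2 ψ₁ ψ₁ = 1) (m : ℕ) :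
    l2 ((transferApply (L := L) β)^[m] ψ₁) ((transferApply β)^[m] ψ₁) = κ₁ ^ (2 * m) := by
  rw [iterate_transferApply_eigen β he₁ m, l2_smul_left, l2_smul_right'', hn₁]
  ring

/-- Form number of the pure dressed channel: `⟨K_β^[m]ψ₁, K_β K_β^[m]ψ₁⟩ = κ₁^{2m+1}`. [folklore] -/
theorem l2_pure_form (he₁ : transferApply β ψ₁ = κ₁ • ψ₁) (hn₁ : l2 ψ₁ ψ₁ = 1) (m : ℕ) :
    l2 ((transferApply (L := L) β)^[m] ψ₁) (transferApply β ((transferApply β)^[m] ψ₁)) = κ₁ ^ (2 * m + 1) := by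
  rw [iterate_transferApply_eigen β he₁ m, transferApply_smul, he₁, smul_smul, l2_smul_left, l2_smul_right'', hn₁]
  ring

/-- Gram cross number of the pair: `⟨K_β^[m]ψ₁, K_β^[m](s•ψ₁ + ψ₂)⟩ = sκ₁^{2m}`. [folklore] -/
theorem l2_pure_cross (h₁ : IsPhys ψ₁) (h₂ : IsPhys ψ₂)
    (he₁ : transferApply β ψ₁ = κ₁ • ψ₁) (he₂ : transferApply β ψ₂ = κ₂ • ψ₂)
    (hn₁ : l2 ψ₁ ψ₁ = 1) (h₁₂ : l2 ψ₁ ψ₂ = 0) (s : ℝ) (m : ℕ) :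
    l2 ((transferApply (L := L) β)^[m] ψ₁) ((transferApply β)^[m] (s • ψ₁ + ψ₂)) = s * κ₁ ^ (2 * m) := by
  rw [iterate_transferApply_eigen β he₁ m, iterate_transferApply_crossMixture β h₁ h₂ he₁ he₂ s m, l2_smul_left,
    l2_add_right h₁ (h₁.smul _) (h₂.smul _), l2_smul_right'', l2_smul_right'', hn₁, h₁₂]
  ring

/-- Form cross number of the pair: `⟨K_β^[m]ψ₁, K_β K_β^[m](s•ψ₁ + ψ₂)⟩ = sκ₁^{2m+1}`. [folklore] -/
theorem l2_pure_crossForm (h₁ : IsPhys ψ₁) (h₂ : IsPhys ψ₂)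
    (he₁ : transferApply β ψ₁ = κ₁ • ψ₁) (he₂ : transferApply β ψ₂ = κ₂ • ψ₂)
    (hn₁ : l2 ψ₁ ψ₁ = 1) (h₁₂ : l2 ψ₁ ψ₂ = 0) (s : ℝ) (m : ℕ) :
    l2 ((transferApply (L := L) β)^[m] ψ₁) (transferApply β ((transferApply β)^[m] (s • ψ₁ + ψ₂))) = s * κ₁ ^ (2 * m + 1) := by
  rw [iterate_transferApply_eigen β he₁ m, iterate_transferApply_crossMixture β h₁ h₂ he₁ he₂ s m, transferApply_twoLevel β h₁ h₂ he₁ he₂,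
    l2_smul_left, l2_add_right h₁ (h₁.smul _) (h₂.smul _), l2_smul_right'', l2_smul_right'', hn₁, h₁₂]
  ring

/-- Gram number of the cross mixture: `‖K_β^[m](s•ψ₁ + ψ₂)‖² = s²κ₁^{2m} + κ₂^{2m}`. [folklore] -/
theorem l2_crossMixture_self (h₁ : IsPhys ψ₁) (h₂ : IsPhys ψ₂)
    (he₁ : transferApply β ψ₁ = κ₁ • ψ₁) (he₂ : transferApply β ψ₂ = κ₂ • ψ₂)
    (hn₁ : l2 ψ₁ ψ₁ = 1) (hn₂ : l2 ψ₂ ψ₂ = 1) (h₁₂ : l2 ψ₁ ψ₂ = 0) (s : ℝ) (m : ℕ) :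
    l2 ((transferApply (L := L) β)^[m] (s • ψ₁ + ψ₂)) ((transferApply β)^[m] (s • ψ₁ + ψ₂)) = s ^ 2 * κ₁ ^ (2 * m) + κ₂ ^ (2 * m) := by
  rw [iterate_transferApply_crossMixture β h₁ h₂ he₁ he₂ s m, l2_twoLevel_pair h₁ h₂ hn₁ hn₂ h₁₂]
  ring

/-- Form number of the cross mixture: `⟨v, K_β v⟩ = s²κ₁^{2m+1} + κ₂^{2m+1}` for `v = K_β^[m](s•ψ₁ + ψ₂)`. [folklore] -/
theorem l2_crossMixture_form (h₁ : IsPhys ψ₁) (h₂ : IsPhys ψ₂)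
    (he₁ : transferApply β ψ₁ = κ₁ • ψ₁) (he₂ : transferApply β ψ₂ = κ₂ • ψ₂)
    (hn₁ : l2 ψ₁ ψ₁ = 1) (hn₂ : l2 ψ₂ ψ₂ = 1) (h₁₂ : l2 ψ₁ ψ₂ = 0) (s : ℝ) (m : ℕ) :
    l2 ((transferApply (L := L) β)^[m] (s • ψ₁ + ψ₂)) (transferApply β ((transferApply β)^[m] (s • ψ₁ + ψ₂))) =
      s ^ 2 * κ₁ ^ (2 * m + 1) + κ₂ ^ (2 * m + 1) := by
  rw [iterate_transferApply_crossMixture β h₁ h₂ he₁ he₂ s m, transferApply_twoLevel β h₁ h₂ he₁ he₂, l2_twoLevel_pair h₁ h₂ hn₁ hn₂ h₁₂]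
  ring

/-- ★ **The (o6) number of the cross pair in closed form.**  For `a = K_β^[m]ψ₁`, `v = K_β^[m](s•ψ₁ + ψ₂)` (`κ₁ ≠ 0`, `‖v‖² ≠ 0`):
`(⟨a,Kv⟩ − ½(⟨a,Ka⟩/‖a‖² + ⟨v,Kv⟩/‖v‖²)·⟨a,v⟩) · 2‖v‖² = s·κ₁^{2m}κ₂^{2m}·(κ₁ − κ₂)` — the commutator clause sees the product of the cross
AMPLITUDE `s`, the dressed weights and the splitting `κ₁ − κ₂`. [cite: LuscherWolff1990] -/
theorem crossPair_o6_number_mul_two_gram (h₁ : IsPhys ψ₁) (h₂ : IsPhys ψ₂)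
    (he₁ : transferApply β ψ₁ = κ₁ • ψ₁) (he₂ : transferApply β ψ₂ = κ₂ • ψ₂)
    (hn₁ : l2 ψ₁ ψ₁ = 1) (hn₂ : l2 ψ₂ ψ₂ = 1) (h₁₂ : l2 ψ₁ ψ₂ = 0) (s : ℝ) (m : ℕ)
    (hκ₁ : κ₁ ≠ 0) (hN : s ^ 2 * κ₁ ^ (2 * m) + κ₂ ^ (2 * m) ≠ 0) :
    (l2 ((transferApply (L := L) β)^[m] ψ₁) (transferApply β ((transferApply β)^[m] (s • ψ₁ + ψ₂))) -
        (l2 ((transferApply (L := L) β)^[m] ψ₁) (transferApply β ((transferApply β)^[m] ψ₁)) /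
              l2 ((transferApply (L := L) β)^[m] ψ₁) ((transferApply β)^[m] ψ₁) +
            l2 ((transferApply (L := L) β)^[m] (s • ψ₁ + ψ₂)) (transferApply β ((transferApply β)^[m] (s • ψ₁ + ψ₂))) /
              l2 ((transferApply (L := L) β)^[m] (s • ψ₁ + ψ₂)) ((transferApply β)^[m] (s • ψ₁ + ψ₂))) / 2 *
          l2 ((transferApply (L := L) β)^[m] ψ₁) ((transferApply β)^[m] (s • ψ₁ + ψ₂))) *
      (2 * l2 ((transferApply (L := L) β)^[m] (s • ψ₁ + ψ₂)) ((transferApply β)^[m] (s • ψ₁ + ψ₂))) =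
    s * κ₁ ^ (2 * m) * κ₂ ^ (2 * m) * (κ₁ - κ₂) := by
  rw [l2_pure_crossForm β h₁ h₂ he₁ he₂ hn₁ h₁₂ s m, l2_pure_form β he₁ hn₁ m, l2_pure_self β he₁ hn₁ m,
    l2_crossMixture_form β h₁ h₂ he₁ he₂ hn₁ hn₂ h₁₂ s m, l2_crossMixture_self β h₁ h₂ he₁ he₂ hn₁ hn₂ h₁₂ s m,
    l2_pure_cross β h₁ h₂ he₁ he₂ hn₁ h₁₂ s m]
  have hk : κ₁ ^ (2 * m) ≠ 0 := pow_ne_zero _ hκ₁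
  field_simp
  ring

/-- ★★ **(o6) fails when (cross-channel AMPLITUDE) × (splitting in units of `λ₀`) exceeds `4·CΛ²/L`.**  Slots `i ≠ l` of `u` carry the pure dressed channel
`u i = K_β^[m]ψ₁` and the leaking one `u l = K_β^[m](s•ψ₁ + ψ₂)` (`ψ₁, ψ₂` an `l2`-orthonormal physical pair of exact eigenvectors, `κ₁, κ₂ > 0`, `β > 0`);
`a` with `a·‖u l‖ ≤ |s|κ₁^m` (any lower bound of the normalised dressed admixture of channel `i` inside channel `l`), leaked weight at most one half
(`2s²κ₁^{2m} ≤ ‖u l‖²`),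
`γ ≥ 0` with `γλ₀ ≤ |κ₁ − κ₂|`; then `4·C·Λ²/L < aγ` ⇒ `¬ DynamicCoreClauses k C β u`. [cite: LuscherWolff1990] -/
theorem not_dynamicCoreClauses_of_crossAmplitude {k : ℕ} (C : ℝ) {u : Fin k → (GaugeConfig 3 L SU2 → ℝ)} {i l : Fin k} (hil : i ≠ l)
    (hβ : 0 < β) (h₁ : IsPhys ψ₁) (h₂ : IsPhys ψ₂)
    (he₁ : transferApply β ψ₁ = κ₁ • ψ₁) (he₂ : transferApply β ψ₂ = κ₂ • ψ₂)
    (hn₁ : l2 ψ₁ ψ₁ = 1) (hn₂ : l2 ψ₂ ψ₂ = 1) (h₁₂ : l2 ψ₁ ψ₂ = 0) (s : ℝ) (m : ℕ)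
    (hui : u i = (transferApply (L := L) β)^[m] ψ₁) (hul : u l = (transferApply (L := L) β)^[m] (s • ψ₁ + ψ₂))
    (hκ₁ : 0 < κ₁) (hκ₂ : 0 < κ₂) {a γ : ℝ} (hγ : 0 ≤ γ)
    (hamp : a * Real.sqrt (s ^ 2 * κ₁ ^ (2 * m) + κ₂ ^ (2 * m)) ≤ |s| * κ₁ ^ m)
    (hdom : 2 * (s ^ 2 * κ₁ ^ (2 * m)) ≤ s ^ 2 * κ₁ ^ (2 * m) + κ₂ ^ (2 * m))
    (hgap : γ * levelValue su2Rep L β 0 ≤ |κ₁ - κ₂|)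
    (htol : 4 * (C * (luscherLambda β L ^ 2 / L)) < a * γ) :
    ¬ DynamicCoreClauses k C β u := by
  intro h
  have h6 := h.2 i l hil
  rw [hui, hul] at h6
  rw [l2_pure_crossForm β h₁ h₂ he₁ he₂ hn₁ h₁₂ s m, l2_pure_form β he₁ hn₁ m, l2_pure_self β he₁ hn₁ m,
    l2_crossMixture_form β h₁ h₂ he₁ he₂ hn₁ hn₂ h₁₂ s m, l2_crossMixture_self β h₁ h₂ he₁ he₂ hn₁ hn₂ h₁₂ s m,
    l2_pure_cross β h₁ h₂ he₁ he₂ hn₁ h₁₂ s m] at h6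
  have hkm : 0 < κ₁ ^ m := pow_pos hκ₁ m
  have hk2 : 0 < κ₁ ^ (2 * m) := pow_pos hκ₁ _
  have hq2 : 0 < κ₂ ^ (2 * m) := pow_pos hκ₂ _
  have hs2 : 0 ≤ s ^ 2 * κ₁ ^ (2 * m) := mul_nonneg (sq_nonneg s) hk2.le
  have hN0 : 0 < s ^ 2 * κ₁ ^ (2 * m) + κ₂ ^ (2 * m) := by linarith
  have hl0 : 0 < levelValue su2Rep L β 0 := levelValue_su2Rep_pos hβ 0
  have hX := crossPair_o6_number_mul_two_gram β h₁ h₂ he₁ he₂ hn₁ hn₂ h₁₂ s m hκ₁.ne' hN0.ne'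
  rw [l2_pure_crossForm β h₁ h₂ he₁ he₂ hn₁ h₁₂ s m, l2_pure_form β he₁ hn₁ m, l2_pure_self β he₁ hn₁ m,
    l2_crossMixture_form β h₁ h₂ he₁ he₂ hn₁ hn₂ h₁₂ s m, l2_crossMixture_self β h₁ h₂ he₁ he₂ hn₁ hn₂ h₁₂ s m,
    l2_pure_cross β h₁ h₂ he₁ he₂ hn₁ h₁₂ s m] at hX
  have habs := congrArg abs hX
  simp only [abs_mul, abs_two, abs_of_pos hN0, abs_of_pos hk2, abs_of_pos hq2] at habs
  have hsqa : Real.sqrt (κ₁ ^ (2 * m)) = κ₁ ^ m := by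
    rw [show κ₁ ^ (2 * m) = (κ₁ ^ m) ^ 2 by rw [← pow_mul, mul_comm], Real.sqrt_sq hkm.le]
  rw [hsqa] at h6
  set N := s ^ 2 * κ₁ ^ (2 * m) + κ₂ ^ (2 * m) with hN_def
  set l0 := levelValue su2Rep L β 0 with hl0_def
  set T := C * (luscherLambda β L ^ 2 / L) with hT_def
  have hsN : 0 < Real.sqrt N := Real.sqrt_pos.mpr hN0
  have h2N : 0 ≤ 2 * N := by linarith
  -- the clause, multiplied by `2‖v‖²`
  have h7 := mul_le_mul_of_nonneg_right h6 h2N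
  rw [habs] at h7
  -- lower bound of the (o6) number: amplitude × weight of the partner × splitting
  have hS : a * Real.sqrt N * κ₁ ^ m ≤ |s| * κ₁ ^ m * κ₁ ^ m := mul_le_mul_of_nonneg_right hamp hkm.le
  have hQ : N / 2 ≤ κ₂ ^ (2 * m) := by rw [hN_def] at hdom ⊢; linarith
  have hLB : a * Real.sqrt N * κ₁ ^ m * (N / 2) * (γ * l0) ≤ |s| * κ₁ ^ m * κ₁ ^ m * κ₂ ^ (2 * m) * |κ₁ - κ₂| :=
    mul_le_mul (mul_le_mul hS hQ (by positivity) (by positivity)) hgap (by positivity) (by positivity)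
  have hLB' : |s| * κ₁ ^ m * κ₁ ^ m * κ₂ ^ (2 * m) * |κ₁ - κ₂| = |s| * κ₁ ^ (2 * m) * κ₂ ^ (2 * m) * |κ₁ - κ₂| := by ring
  rw [hLB'] at hLB
  -- tolerance: `4T < aγ`, times the positive number `l0·κ₁^m·N·√N/2`
  have hP : 0 < l0 * κ₁ ^ m * N * Real.sqrt N := by positivity
  have h8 := mul_lt_mul_of_pos_right htol (half_pos hP)
  have h9 : T * l0 * (κ₁ ^ m * Real.sqrt N) * (2 * N) = 4 * T * (l0 * κ₁ ^ m * N * Real.sqrt N / 2) := by ring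
  have h10 : a * Real.sqrt N * κ₁ ^ m * (N / 2) * (γ * l0) = a * γ * (l0 * κ₁ ^ m * N * Real.sqrt N / 2) := by ring
  rw [h9] at h7
  rw [h10] at hLB
  linarith

end CrossPair

end Summit.QuantumFields.YangMills.Theorems.FemtoTransferGap.PolyakovLift.Negative

end
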